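import Summits.Ventures.Crystal3D.Theorems.StickyWulffConstantGenericWallFloorBarlowMachineStep
import Summits.Ventures.Crystal3D.Theorems.StickyWulffConstantTextureLiminfFluxZigzagSel
import HarnessLib

/-!
# The walk machine's steps form a zigzag step SELECTOR in lane T's sense (`IsZigSelector`), orientation `axisSign = +1`
# (crux `GenericWallFloor`, stmt-Ventures-19480, line `WallLedgerG`; lane T's F4 — wulff-p2 16:32:00Z: «instantiate with the machine's steps»)

HONEST FRAMING. Venture `Summits/Ventures/Crystal3D` (cell `crystal3d-full`), helper `--supports` the crux `GenericWallFloor`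
(stmt-Ventures-19480) of `route-Ventures-StickyWulffConstant`, registered line `WallLedgerG`, open stub `stub_twoSlabAdhesion`.
Rung credit only; F-C1 not moved; NOT the stub.

Lane T's restated flux count (`plate_lines_ge_flux_sel`, `cell_charge_le_lines_sel`, wulff-p2 p647456/p647588) is parametrised by a
selector `step : ℤ → E3` with `IsZigSelector L σ e step` (`…TextureLiminfFluxZigzagSel`: each `step k` is an e-upward bond of bilayer
`zigSlab k` in normal form `IsUpBond`, and its rise is `bilayerRise`).  For the MACHINE's steps `ms` (family slot
`v₀ := best3 (⟪·, L⁻¹e⟫) upSlot₁ upSlot₂ upSlot₃` on Δ-bilayers, `basalMirror (bestCapper G (L e₃) e)` on ∇-bilayers) in the orientation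
`0 ≤ (L⁻¹e)₂` (so `axisSign = 1`, `zigSlab k = k`):

* `isUpBond_machineStep` — `IsUpBond L σ e m (ms m)` (Δ: `v₀` is one of the three reference upper slots; ∇: `−q` is, by
  `eq_upSlot_of_apply_two`, so `basalMirror q = basalMirror (−(−q))`);
* **`isZigSelector_machineStep`** — `IsZigSelector L σ e (fun k => ms (zigSlab L e k))` (rise from `machineStep_spec`).
WHAT THIS IS NOT: the `axisSign = −1` orientation (word reversal, p639985's `isHaggSeq_reverse` / `basalMirror_barlowPos_eq_reverse`);
F-C1 not moved.
-/

noncomputable section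

namespace Summit.Ventures.Crystal3D.Theorems

open Finset
open Literature.MathematicalPhysics.StatisticalMechanics
open Summit.Ventures.Crystal3D.Cruxes.TextureLiminf.TexShadow (upSlot₁ upSlot₂ upSlot₃ bondRise bilayerRise)
open scoped InnerProductSpace

section Oriented

variable (σ : ℤ → ℤ) (L : EuclideanSpace ℝ (Fin 3) ≃ₗᵢ[ℝ] EuclideanSpace ℝ (Fin 3)) (e v₀ : EuclideanSpace ℝ (Fin 3))
  (ms : ℤ → EuclideanSpace ℝ (Fin 3))

/-- **Each machine step is an e-upward bond in lane T's normal form.** -/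
theorem isUpBond_machineStep (hσ : IsHaggSeq σ) (hax : 0 ≤ (L.symm e) 2)
    (hv₀ : v₀ = best3 (fun w => ⟪w, L.symm e⟫_ℝ) upSlot₁ upSlot₂ upSlot₃)
    (hms₁ : ∀ m, σ m = 1 → ms m = v₀)
    (hms₂ : ∀ m, σ m = -1 → ms m =
      basalMirror (bestCapper (twinFrame L (L (EuclideanSpace.single (2 : Fin 3) (1 : ℝ)))) (L (EuclideanSpace.single (2 : Fin 3) (1 : ℝ))) e))
    (m : ℤ) : IsUpBond L σ e m (ms m) := by
  have hax1 : axisSign L e = 1 := by simp [axisSign, hax]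
  rcases hσ m with hm | hm
  · -- Δ: the family slot is a reference upper slot
    rcases best3_mem (fun w => ⟪w, L.symm e⟫_ℝ) upSlot₁ upSlot₂ upSlot₃ with h | h | h
    · exact ⟨0, 0, Or.inl ⟨rfl, rfl⟩, by rw [hms₁ m hm, hv₀, h, hax1, one_smul, if_pos hm]; rfl⟩
    · exact ⟨-1, 0, Or.inr (Or.inl ⟨rfl, rfl⟩), by rw [hms₁ m hm, hv₀, h, hax1, one_smul, if_pos hm]; rfl⟩
    · exact ⟨0, -1, Or.inr (Or.inr ⟨rfl, rfl⟩), by rw [hms₁ m hm, hv₀, h, hax1, one_smul, if_pos hm]; rfl⟩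
  · -- ∇: the best capper is the negative of a reference upper slot
    obtain ⟨hq, hq2⟩ := bestCapper_nabla_slot L e
    have hm' : ¬ σ m = 1 := by rw [hm]; decide
    have hneg := eq_upSlot_of_apply_two (neg_mem_fccSlots hq) (by simp [hq2])
    have key : ∀ w : EuclideanSpace ℝ (Fin 3),
        -bestCapper (twinFrame L (L (EuclideanSpace.single (2 : Fin 3) (1 : ℝ)))) (L (EuclideanSpace.single (2 : Fin 3) (1 : ℝ))) e = w →
        ms m = axisSign L e • (if σ m = 1 then w else basalMirror (-w)) := by
      intro w hw
      rw [hms₂ m hm, hax1, one_smul, if_neg hm', ← hw, neg_neg]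
    rcases hneg with h | h | h
    · exact ⟨0, 0, Or.inl ⟨rfl, rfl⟩, key _ h⟩
    · exact ⟨-1, 0, Or.inr (Or.inl ⟨rfl, rfl⟩), key _ h⟩
    · exact ⟨0, -1, Or.inr (Or.inr ⟨rfl, rfl⟩), key _ h⟩

/-- **The machine's steps form a zigzag selector** (orientation `axisSign = +1`). -/
theorem isZigSelector_machineStep (hσ : IsHaggSeq σ) (hax : 0 ≤ (L.symm e) 2)
    (hv₀ : v₀ = best3 (fun w => ⟪w, L.symm e⟫_ℝ) upSlot₁ upSlot₂ upSlot₃)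
    (hms₁ : ∀ m, σ m = 1 → ms m = v₀)
    (hms₂ : ∀ m, σ m = -1 → ms m =
      basalMirror (bestCapper (twinFrame L (L (EuclideanSpace.single (2 : Fin 3) (1 : ℝ)))) (L (EuclideanSpace.single (2 : Fin 3) (1 : ℝ))) e)) :
    IsZigSelector L σ e (fun k => ms (zigSlab L e k)) := by
  intro k
  have hk : zigSlab L e k = k := by simp [zigSlab, hax]
  refine ⟨?_, ?_⟩
  · show IsUpBond L σ e (zigSlab L e k) (ms (zigSlab L e k))
    exact isUpBond_machineStep σ L e v₀ ms hσ hax hv₀ hms₁ hms₂ _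
  · show ⟪ms (zigSlab L e k), L.symm e⟫_ℝ = bilayerRise L σ e (zigSlab L e k)
    exact (machineStep_spec σ L e v₀ ms hσ hax hv₀ hms₁ hms₂ _).1

end Oriented

end Summit.Ventures.Crystal3D.Theorems

end
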